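import Summits.ABC.IUTFork.Thm311RealIndTraceInvariant
import Mathlib.Topology.Algebra.Module.FiniteDimension
import Mathlib.Analysis.Normed.Module.Basic
import HarnessLib

/-!
# [IUTchIII] Thm 3.11 (i) (Ind1)+(Ind2) at `v ∈ 𝕍^non`: NO RADIAL INFLATION — no element of the single-place indeterminacy group
# maps a compact region onto a set containing a STRICT HOMOTHETIC ENLARGEMENT of it (unconditional)

PROOF-ONLY file (abc-iut cell, Cor. 3.12 sub-crew, seat abc-iut-c312-1 = holder of record of the typed [IUTchIII] Thm. 3.11,
gen 11; row «R13 TRACE-RIGIDITY», part c).  TAKES NO SIDE on [IUTchIII] Cor. 3.12.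

Part b (`Thm311RealIndTraceInvariant`, p494948) proved that `|Tr_{K_v/ℚ_p}(γ x)|_p = |Tr(x)|_p` for every `γ` in the subgroup of
`Aut_ℚ(K_v)` generated by print's (Ind1) strip part `Real.ind1Strip (analyticLogv F) v` and print's (Ind2) `Real.ismIsm (analyticLogv F) v`.
Consequence, here:
* **`Real.not_smul_subset_image_of_mem_closure_ind`** — for every COMPACT `S ⊆ K_v` containing an element of non-zero trace and every
  `c ∈ ℚ_p` with `|c|_p > 1`: `c·S ⊄ γ(S)` (read in abc-iut-S7's rescaled completion; `|Tr|` attains its maximum `M > 0` on `S`, and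
  `γ(S)` has the same maximum while `c·S` has `|c|·M`).
* **`Real.not_closedBall_subset_image_of_mem_closure_ind`** — in particular NO `γ` maps an ideal-shaped region `B(0, r)`, `r > 0`, onto
  a set containing the next larger homothetic ball `B(0, |c|·r)`, `|c|_p > 1` (`p^n ∈ B(0,r)` has trace `[K_v:ℚ_p]·p^n ≠ 0`).
READING (neutral, about OUR typed objects): whatever inflation print's single-place (Ind1)-strip and (Ind2) indeterminacies effect on
regions of the real log-shell carrier — gen 10 (modulo Jannsen–Wingberg, `f(v|p)` odd, `e(v|p) ≥ 3`): some `χ` inflates some `𝔪_v^m`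
by index `≥ p` — is NEVER radial: `χ(𝔪_v^m) ⊉ 𝔪_v^{m−1}`, unconditionally, for every element of the generated group.  Dupuy–Hilado's
`Aut_{ℚ_p}(K_v : I_v)` (c312-5 `Real.ismDH`) is not subject to this constraint when `n_v ≥ 2` (it contains `GL_{ℤ_p}(I_v)`).
HONEST SCOPE: single place; the packet-level group `LogShells.IndGroup` also permutes capsule indices (untouched); nothing here asserts
or refutes [IUTchIII] Cor. 3.12.  [claim: Mochizuki2012, status: disputed]; [cite: HoshiNishio2022OuterAutMLF, Lemma 2.3 (ii) p.7];
[cite: DupuyHilado2025, §4.9].  typed ≠ proved.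
-/

set_option autoImplicit false

noncomputable section

open Metric Set
open scoped Pointwise

namespace Summit.ABC.IUTFork.Thm311.Real

open NumberField IsDedekindDomain Literature.NumberTheory.NumberFields Literature.IUT.LogVolume
open Literature.NumberTheory.GaloisRepresentations Literature.NumberTheory.GaloisRepresentations.Ultrametric
open Literature.AnabelianGeometry.AbsoluteAnabelian Literature.IUT.HodgeArakelov
open Literature.IUT.HodgeArakelov.AbsTopMonoids Literature.IUT.LogThetaLattice

variable {F : Type} [Field F] [NumberField F] (v : HeightOneSpectrum (𝓞 F)) [hp : Fact (closureAt v).residueChar.Prime]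

/-- **NO RADIAL INFLATION (compact regions).**  Let `γ` lie in the subgroup of `Aut_ℚ(K_v)` generated by print's (Ind1) strip part and
(Ind2) at `v` (`Real.ind1Strip (analyticLogv F) v ∪ Real.ismIsm (analyticLogv F) v`), read on `K_v^{(1/n_v)}` through the identity
`of`.  For every compact `S ⊆ K_v^{(1/n_v)}` containing an element of non-zero trace `Tr_{K_v/ℚ_{p_v}}` and every `c ∈ ℚ_{p_v}` with
`|c|_p > 1`: `c · S ⊄ γ(S)`.  (`|Tr|` is continuous and attains a maximum `M > 0` on `S`; `γ(S)` has maximum `M` by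
`norm_trace_apply_eq_of_mem_closure_ind`; `c·S` has maximum `|c|·M > M`.) [claim: Mochizuki2012, status: disputed]
[cite: HoshiNishio2022OuterAutMLF, Lemma 2.3 (ii) p.7] -/
theorem not_smul_subset_image_of_mem_closure_ind {γ : Carrier (.inr v : Place F) ≃ₗ[ℚ] Carrier (.inr v : Place F)}
    (hγ : γ ∈ Subgroup.closure (ind1Strip (analyticLogv F) v ∪ ismIsm (analyticLogv F) v))
    {S : Set (RescaledCompletion F (closureAt v).residueChar v (natCast_residueChar_closureAt_mem v))} (hS : IsCompact S)
    (hS1 : ∃ x ∈ S, Algebra.trace ℚ_[(closureAt v).residueChar]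
      (RescaledCompletion F (closureAt v).residueChar v (natCast_residueChar_closureAt_mem v)) x ≠ 0)
    {c : ℚ_[(closureAt v).residueChar]} (hc : 1 < ‖c‖) :
    ¬ (c • S ⊆ (fun x => RescaledCompletion.of F (closureAt v).residueChar v (natCast_residueChar_closureAt_mem v)
        (γ ((RescaledCompletion.of F (closureAt v).residueChar v (natCast_residueChar_closureAt_mem v)).symm x))) '' S) := by
  set hv := natCast_residueChar_closureAt_mem v
  set e := RescaledCompletion.of F (closureAt v).residueChar v hv with he
  set Tr := Algebra.trace ℚ_[(closureAt v).residueChar] (RescaledCompletion F (closureAt v).residueChar v hv) with hTr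
  haveI : FiniteDimensional ℚ_[(closureAt v).residueChar] (RescaledCompletion F (closureAt v).residueChar v hv) :=
    FiniteDimensional.of_locallyCompactSpace ℚ_[(closureAt v).residueChar]
  intro hsub
  -- `|Tr|` is continuous and attains its maximum on `S`
  have hcont : Continuous fun x : RescaledCompletion F (closureAt v).residueChar v hv => ‖Tr x‖ :=
    continuous_norm.comp Tr.continuous_of_finiteDimensional
  obtain ⟨x₁, hx₁, hx₁0⟩ := hS1
  obtain ⟨x₀, hx₀, hmax⟩ := hS.exists_isMaxOn ⟨x₁, hx₁⟩ hcont.continuousOn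
  have hM : 0 < ‖Tr x₀‖ := (norm_pos_iff.mpr hx₁0).trans_le (hmax hx₁)
  -- `c • x₀ ∈ γ(S)`, say `= γ x₂`
  obtain ⟨x₂, hx₂, hγx₂⟩ := hsub (Set.smul_mem_smul_set hx₀)
  have hinv := norm_trace_apply_eq_of_mem_closure_ind v hγ (e.symm x₂)
  rw [RingEquiv.apply_symm_apply] at hinv
  have h1 : ‖Tr (c • x₀)‖ = ‖Tr x₂‖ := by rw [← hγx₂]; exact hinv
  rw [map_smul, smul_eq_mul, norm_mul] at h1
  have h2 : ‖Tr x₂‖ ≤ ‖Tr x₀‖ := hmax hx₂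
  have h3 : ‖Tr x₀‖ < ‖c‖ * ‖Tr x₀‖ := lt_mul_left hM hc
  linarith

/-- **NO RADIAL INFLATION OF IDEAL-SHAPED REGIONS**: for `γ` in the single-place indeterminacy group generated by print's (Ind1) strip
part and (Ind2) at `v`, every radius `r > 0` and every `c ∈ ℚ_{p_v}` with `|c|_p > 1`, the image `γ(B(0, r))` does NOT contain the
homothetic ball `B(0, |c|·r)` (balls of abc-iut-S7's rescaled norm on `K_v`; `p^n ∈ B(0,r)` has trace `[K_v : ℚ_p]·p^n ≠ 0`).  E.g.
`γ(𝔪_v^m) ⊉ 𝔪_v^{m − e(v|p)}` (`c = p⁻¹`).  Contrast: modulo Jannsen–Wingberg some `χ` of the (Ind1) strip part inflates some `𝔪_v^m` by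
INDEX `≥ p` (gen 10/11, `exists_prime_le_relIndex_of_jannsenWingberg_odd`) — sideways, inside the level sets of `|Tr|_p`, never
radially. [claim: Mochizuki2012, status: disputed] [cite: HoshiNishio2022OuterAutMLF, Lemma 2.3 (ii) p.7] -/
theorem not_closedBall_subset_image_of_mem_closure_ind {γ : Carrier (.inr v : Place F) ≃ₗ[ℚ] Carrier (.inr v : Place F)}
    (hγ : γ ∈ Subgroup.closure (ind1Strip (analyticLogv F) v ∪ ismIsm (analyticLogv F) v))
    {r : ℝ} (hr : 0 < r) {c : ℚ_[(closureAt v).residueChar]} (hc : 1 < ‖c‖) :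
    ¬ (closedBall (0 : RescaledCompletion F (closureAt v).residueChar v (natCast_residueChar_closureAt_mem v)) (‖c‖ * r) ⊆
        (fun x => RescaledCompletion.of F (closureAt v).residueChar v (natCast_residueChar_closureAt_mem v)
          (γ ((RescaledCompletion.of F (closureAt v).residueChar v (natCast_residueChar_closureAt_mem v)).symm x))) ''
        closedBall (0 : RescaledCompletion F (closureAt v).residueChar v (natCast_residueChar_closureAt_mem v)) r) := by
  set hv := natCast_residueChar_closureAt_mem v
  haveI : FiniteDimensional ℚ_[(closureAt v).residueChar] (RescaledCompletion F (closureAt v).residueChar v hv) :=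
    FiniteDimensional.of_locallyCompactSpace ℚ_[(closureAt v).residueChar]
  have hc0 : c ≠ 0 := fun h => by rw [h, norm_zero] at hc; exact absurd hc (not_lt.mpr zero_le_one)
  -- `c • B(0,r) = B(0, |c| r)`
  have hball : c • closedBall (0 : RescaledCompletion F (closureAt v).residueChar v hv) r =
      closedBall (0 : RescaledCompletion F (closureAt v).residueChar v hv) (‖c‖ * r) := by
    rw [smul_closedBall' hc0, smul_zero]
  rw [← hball]
  refine not_smul_subset_image_of_mem_closure_ind v hγ (isCompact_closedBall _ _) ?_ hc
  -- an element of `ℚ_p · 1` with non-zero trace inside `B(0, r)`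
  obtain ⟨n, hn⟩ : ∃ n : ℕ, ‖((closureAt v).residueChar : ℚ_[(closureAt v).residueChar])‖ ^ n < r :=
    exists_pow_lt_of_lt_one hr (Padic.norm_p_lt_one (p := (closureAt v).residueChar))
  refine ⟨algebraMap ℚ_[(closureAt v).residueChar] _ (((closureAt v).residueChar : ℚ_[(closureAt v).residueChar]) ^ n), ?_, ?_⟩
  · rw [mem_closedBall, dist_zero_right, norm_algebraMap', norm_pow]
    exact hn.le
  · rw [Algebra.trace_algebraMap]
    refine smul_ne_zero (Module.finrank_pos.ne') (pow_ne_zero n ?_)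
    exact_mod_cast hp.out.ne_zero

end Summit.ABC.IUTFork.Thm311.Real

end
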